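/-
Copyright (c) 2026 the pub-hodgecm-mathlib formalisation cell (harness21).  Prover seat hodgecm-mathlib-K2Liu-p10 (g2), Track B «K2-LIT»,
#184♮ = hLiu418 = `stmt-HodgeConjecture-24832`; LEAD F0P6-plan (g13) RULING «M-157a» (1) ∕ «M-157c» (8): G5-a sub-organ (δ)-0 (the Siegel-height
comparison MW I.2.2 (vii) for `GL_n`, by the product formula) — file 2∕2: the comparison.  THEOREMS ONLY (no `def`, no `instance`, no named-fact
hypothesis, no `sorry`).
-/
import Summits.HodgeConjecture.HodgeConjecture.Theorems.K2LiuIdeleEntryHeightBound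
import Literature.NumberTheory.Automorphic.AdelicHeightGLSiegel
import Literature.NumberTheory.Automorphic.GLnMaximalCompactCompact
import Literature.NumberTheory.Automorphic.IdeleClassGroupProofs
import HarnessLib

/-!
# Crux `HLiu418`, ROAD Φ, (δ)-0 file 2: THE SIEGEL-HEIGHT COMPARISON ON `GL_n(𝔸_K)` — the torus coordinate of a reduced word is
# controlled by the adelic height: `aᵢ, aᵢ⁻¹ ≤ C · ‖γ z ω ρ(a) k‖²`

Cell `hodgecm-mathlib`, crux item hLiu418 = `stmt-HodgeConjecture-24832` (helper lane, count-neutral).  For the words of reduction theory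
(★ `reductionTheory_gl`: `GL_n(𝔸_K) = GL_n(K) · A_G · Ω · A_{T₀}(t) · K`), i.e.
`g = γ · z · (ω · ρ(a) · k)` with `γ ∈ GL_n(K)` (★ `rationalPointsGL`), `z = ρ(r) · 1ₙ ∈ A_G` (★ `posRealScalar`),
`ω ∈ N(𝔸_K) · T(𝔸_K)¹` (★ `upperUnitriangular · normOneDiagonal`), `ρ(a) = diag(ρ(a₁), …, ρ(aₙ))` in the cone `∏ aᵢ = 1`,
`t aᵢ₊₁ ≤ aᵢ` (★ `siegelCone`) and `k ∈ K` (★ `standardMaximalCompactGL`), we prove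
**`exists_siegelCoord_le_adelicHeightGL_sq`: `aᵢ ≤ C ‖g‖²` and `aᵢ⁻¹ ≤ C ‖g‖²` for every `i`**, with `C` depending only on
`n, K, t` (Moeglin–Waldspurger I.2.2 (vii): the height of a point of a Siegel domain is comparable with that of any
`G(k)`-translate; Borel–Jacquet 1979, §1.2; here in the crude quadratic form that the moderate-growth estimate (δ) needs).
PROOF BY THE PRODUCT FORMULA (no Siegel finiteness, no compactness of `Ω`): with `g₀ := γ z ω ρ(a) = g k⁻¹`,
* (B) the FIRST COLUMN of the upper-triangular `ω ρ(a)` is `ω₁₁ ρ(a₁) e₁`, so `(g₀)_{i1} = γ_{i1} · ρ(r) · m₁ · ρ(a₁)` is — for a row `i`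
  with `γ_{i1} ≠ 0`, which exists since `γ` is invertible — an idèle of norm `(a₁ r)^{[K:ℚ]}` (product formula ★ `ideleNorm_principal`,
  `|m₁| = 1`, ★ `ideleNorm_posRealIdele_holds`), whence `a₁ r ≤ ‖g₀‖` (file 1, `le_adelicHeightGL_of_ideleNorm_eq_pow`);
* (C) the LAST ROW of `(ω ρ(a))⁻¹` is `ρ(aₙ)⁻¹ mₙ⁻¹ eₙ`, so `(g₀⁻¹)_{nj} = ρ(aₙ r)⁻¹ mₙ⁻¹ (γ⁻¹)_{nj}` and `(aₙ r)⁻¹ ≤ ‖g₀⁻¹‖ = ‖g₀‖`;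
* (D) hence `a₁/aₙ ≤ ‖g₀‖² ≤ (n ‖g‖ ‖k⁻¹‖)²` (★ `adelicHeightGL_mul_le_const`, ★ `exists_adelicHeightGL_le_of_isCompact` on the compact
  ★ `isCompact_standardMaximalCompactGL`), and on the cone `aᵢ, aᵢ⁻¹ ≤ max(1,t⁻¹)^{2n} a₁/aₙ` (★ `siegelCone_apply_le`,
  ★ `siegelCone_inv_apply_le`).
Sources: [MoeglinWaldspurger1995, I.2.2 (vii)]; [BorelJacquet1979, §1.2]; [GetzHahn2024, §2.7 and Lemma 6.3.1].
HONEST LABEL.  Helper lemmas, count-neutral; `HC_CM` is proved only modulo the 7 printed citations (2 remaining named inputs: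
hLiu418 = `stmt-HodgeConjecture-24832`, h413 = `stmt-HodgeConjecture-24833`) until rung 0 closes.
-/

set_option autoImplicit false
set_option linter.dupNamespace false -- the mandated namespace repeats `HodgeConjecture.HodgeConjecture`

noncomputable section

namespace Summit.HodgeConjecture.HodgeConjecture.Cruxes.HLiu418.K2LiuSiegelHeightComparisonGLn

open scoped NNReal MatrixGroups Pointwise Classical
open NumberField IsDedekindDomain
open Literature.NumberTheory.Automorphic
open Literature.NumberTheory.GaloisRepresentations (ideleGroup)
open Summit.HodgeConjecture.HodgeConjecture.Cruxes.HLiu418.K2LiuIdeleEntryHeightBound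

/-! ## 1. Matrix algebra: the first column and the last row of an upper unitriangular matrix -/

section MatrixAlgebra

variable {R : Type*} [CommRing R] {n : ℕ}

/-- The first column of an upper unitriangular matrix is `e₁`. [folklore] -/
theorem upperUnitriangular_apply_first {u : GL (Fin n) R} (hu : u ∈ upperUnitriangular (Fin n) R) (hn : 0 < n) (l : Fin n) :
    (u : Matrix (Fin n) (Fin n) R) l ⟨0, hn⟩ = if l = ⟨0, hn⟩ then 1 else 0 := by
  rw [mem_upperUnitriangular_iff] at hu
  split_ifs with h
  · rw [h]
    exact hu.2 _
  · have hlt : (⟨0, hn⟩ : Fin n) < l := by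
      rw [Fin.lt_def]
      exact Nat.pos_of_ne_zero fun h0 => h (Fin.ext h0)
    exact hu.1 hlt

/-- The last row of an upper unitriangular matrix is `eₙ`. [folklore] -/
theorem upperUnitriangular_apply_last {u : GL (Fin n) R} (hu : u ∈ upperUnitriangular (Fin n) R) (hn : 0 < n) (j : Fin n) :
    (u : Matrix (Fin n) (Fin n) R) ⟨n - 1, by omega⟩ j = if j = ⟨n - 1, by omega⟩ then 1 else 0 := by
  rw [mem_upperUnitriangular_iff] at hu
  split_ifs with h
  · rw [h]
    exact hu.2 _
  · have hlt : j < (⟨n - 1, by omega⟩ : Fin n) := by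
      rw [Fin.lt_def]
      have hj := j.2
      have hne : (j : ℕ) ≠ n - 1 := fun h0 => h (Fin.ext h0)
      change (j : ℕ) < n - 1
      omega
    exact hu.1 hlt

/-- `(P · u · diag(δ))_{i1} = P_{i1} δ₁` for `u` upper unitriangular. [folklore] -/
theorem mul_unip_mul_diagonal_apply_first (P : Matrix (Fin n) (Fin n) R) {u : GL (Fin n) R} (hu : u ∈ upperUnitriangular (Fin n) R)
    (δ : Fin n → R) (hn : 0 < n) (i : Fin n) :
    (P * ((u : Matrix (Fin n) (Fin n) R) * Matrix.diagonal δ)) i ⟨0, hn⟩ = P i ⟨0, hn⟩ * δ ⟨0, hn⟩ := by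
  rw [Matrix.mul_apply, Finset.sum_eq_single ⟨0, hn⟩]
  · rw [Matrix.mul_diagonal, upperUnitriangular_apply_first hu hn, if_pos rfl, one_mul]
  · intro l _ hl
    rw [Matrix.mul_diagonal, upperUnitriangular_apply_first hu hn, if_neg hl, zero_mul, mul_zero]
  · intro h
    exact absurd (Finset.mem_univ _) h

/-- `(diag(δ) · u · Q)_{nj} = δₙ Q_{nj}` for `u` upper unitriangular. [folklore] -/
theorem diagonal_mul_unip_mul_apply_last (Q : Matrix (Fin n) (Fin n) R) {u : GL (Fin n) R} (hu : u ∈ upperUnitriangular (Fin n) R)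
    (δ : Fin n → R) (hn : 0 < n) (j : Fin n) :
    (Matrix.diagonal δ * (u : Matrix (Fin n) (Fin n) R) * Q) ⟨n - 1, by omega⟩ j = δ ⟨n - 1, by omega⟩ * Q ⟨n - 1, by omega⟩ j := by
  rw [Matrix.mul_apply, Finset.sum_eq_single ⟨n - 1, by omega⟩]
  · rw [Matrix.diagonal_mul, upperUnitriangular_apply_last hu hn, if_pos rfl, mul_one]
  · intro l _ hl
    rw [Matrix.diagonal_mul, upperUnitriangular_apply_last hu hn, if_neg hl, mul_zero, zero_mul]
  · intro h
    exact absurd (Finset.mem_univ _) h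

/-- An invertible matrix over a field has a non-zero entry in every column. [folklore] -/
theorem exists_apply_ne_zero_of_column {F : Type*} [Field F] (γ : GL (Fin n) F) (j : Fin n) :
    ∃ i, (γ : Matrix (Fin n) (Fin n) F) i j ≠ 0 := by
  by_contra h
  push Not at h
  have hdet : (γ : Matrix (Fin n) (Fin n) F).det = 0 := Matrix.det_eq_zero_of_column_eq_zero j h
  exact (Matrix.GeneralLinearGroup.det γ).ne_zero (by rwa [Matrix.GeneralLinearGroup.val_det_apply])

/-- An invertible matrix over a field has a non-zero entry in every row. [folklore] -/
theorem exists_apply_ne_zero_of_row {F : Type*} [Field F] (γ : GL (Fin n) F) (i : Fin n) :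
    ∃ j, (γ : Matrix (Fin n) (Fin n) F) i j ≠ 0 := by
  by_contra h
  push Not at h
  have hdet : (γ : Matrix (Fin n) (Fin n) F).det = 0 := Matrix.det_eq_zero_of_row_eq_zero i h
  exact (Matrix.GeneralLinearGroup.det γ).ne_zero (by rwa [Matrix.GeneralLinearGroup.val_det_apply])

end MatrixAlgebra

/-! ## 2. The two idelic entries of a reduced word -/

section Entries

variable {K : Type} [Field K] [NumberField K] {n : ℕ}

/-- **(B) `a₁ · r ≤ ‖γ · ρ(r) · ω · ρ(a)‖`**: the `(i,1)` entry of `g₀ = γ z ω ρ(a)` is the idèle `γ_{i1} ρ(r) m₁ ρ(a₁)` of norm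
`(a₁ r)^{[K:ℚ]}` for a row `i` with `γ_{i1} ≠ 0`. [cite: MoeglinWaldspurger1995, I.2.2 (vii)] -/
theorem first_mul_le_adelicHeightGL (hn : 0 < n) {γ z ω : GL (Fin n) (AdeleRing (𝓞 K) K)} (hγ : γ ∈ rationalPointsGL n K)
    {r : ℝ≥0ˣ} (hz : posRealScalar n K r = z)
    (hω : ω ∈ (upperUnitriangular (Fin n) (AdeleRing (𝓞 K) K) : Set (GL (Fin n) (AdeleRing (𝓞 K) K))) *
      (normOneDiagonal n K : Set (GL (Fin n) (AdeleRing (𝓞 K) K))))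
    (a : Fin n → ℝ≥0ˣ) :
    ((a ⟨0, hn⟩ : ℝ≥0) : ℝ) * ((r : ℝ≥0) : ℝ) ≤ adelicHeightGL n K (γ * z * (ω * posRealDiagonal n K a)) := by
  haveI : NeZero n := ⟨hn.ne'⟩
  obtain ⟨γ', rfl⟩ : ∃ γ' : GL (Fin n) K, Matrix.GeneralLinearGroup.map (algebraMap K (AdeleRing (𝓞 K) K)) γ' = γ := hγ
  obtain ⟨u, hu, d, hd, rfl⟩ := Set.mem_mul.1 hω
  obtain ⟨m, hm1, rfl⟩ := mem_normOneDiagonal_iff.1 hd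
  subst hz
  obtain ⟨i, hi⟩ := exists_apply_ne_zero_of_column γ' ⟨0, hn⟩
  -- the idèle occupying the `(i,1)` slot
  set uι : ideleGroup K := Units.map (algebraMap K (AdeleRing (𝓞 K) K) : K →* AdeleRing (𝓞 K) K) (Units.mk0 _ hi) *
    posRealIdele K r * (m ⟨0, hn⟩ * posRealIdele K (a ⟨0, hn⟩)) with huι
  have hentry : ((Matrix.GeneralLinearGroup.map (algebraMap K (AdeleRing (𝓞 K) K)) γ' * posRealScalar n K r *
      (u * glDiagonal n (AdeleRing (𝓞 K) K) m * posRealDiagonal n K a) : GL (Fin n) (AdeleRing (𝓞 K) K)) :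
        Matrix (Fin n) (Fin n) (AdeleRing (𝓞 K) K)) i ⟨0, hn⟩ = (uι : AdeleRing (𝓞 K) K) := by
    rw [posRealScalar_eq_posRealDiagonal_const]
    simp only [Units.val_mul, coe_posRealDiagonal, coe_glDiagonal]
    rw [mul_assoc (u : Matrix (Fin n) (Fin n) (AdeleRing (𝓞 K) K)), Matrix.diagonal_mul_diagonal,
      mul_unip_mul_diagonal_apply_first _ hu _ hn i, Matrix.mul_diagonal, Matrix.GeneralLinearGroup.map_apply]
    rw [huι]
    simp only [Units.val_mul, Units.coe_map, MonoidHom.coe_coe, Units.val_mk0]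
  have hnorm : (IdeleClassGroup.ideleNorm K uι : ℝ) = (((a ⟨0, hn⟩ : ℝ≥0) : ℝ) * ((r : ℝ≥0) : ℝ)) ^ Module.finrank ℚ K := by
    rw [huι, map_mul, map_mul, map_mul, ideleNorm_principal ⟨Units.mk0 _ hi, rfl⟩, hm1 ⟨0, hn⟩,
      ideleNorm_posRealIdele_holds K r, ideleNorm_posRealIdele_holds K (a ⟨0, hn⟩)]
    push_cast
    ring
  exact le_adelicHeightGL_of_ideleNorm_eq_pow _ i ⟨0, hn⟩ uι (Or.inl hentry) hnorm

/-- **(C) `(aₙ · r)⁻¹ ≤ ‖γ · ρ(r) · ω · ρ(a)‖`**: the `(n,j)` entry of `g₀⁻¹ = ρ(a)⁻¹ ω⁻¹ ρ(r)⁻¹ γ⁻¹` is the idèle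
`ρ(aₙ)⁻¹ mₙ⁻¹ ρ(r)⁻¹ (γ⁻¹)_{nj}` of norm `(aₙ r)^{-[K:ℚ]}` for a column `j` with `(γ⁻¹)_{nj} ≠ 0`. [cite: MoeglinWaldspurger1995, I.2.2 (vii)] -/
theorem last_mul_inv_le_adelicHeightGL (hn : 0 < n) {γ z ω : GL (Fin n) (AdeleRing (𝓞 K) K)} (hγ : γ ∈ rationalPointsGL n K)
    {r : ℝ≥0ˣ} (hz : posRealScalar n K r = z)
    (hω : ω ∈ (upperUnitriangular (Fin n) (AdeleRing (𝓞 K) K) : Set (GL (Fin n) (AdeleRing (𝓞 K) K))) *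
      (normOneDiagonal n K : Set (GL (Fin n) (AdeleRing (𝓞 K) K))))
    (a : Fin n → ℝ≥0ˣ) :
    (((a ⟨n - 1, by omega⟩ : ℝ≥0) : ℝ) * ((r : ℝ≥0) : ℝ))⁻¹ ≤ adelicHeightGL n K (γ * z * (ω * posRealDiagonal n K a)) := by
  haveI : NeZero n := ⟨hn.ne'⟩
  obtain ⟨γ', rfl⟩ : ∃ γ' : GL (Fin n) K, Matrix.GeneralLinearGroup.map (algebraMap K (AdeleRing (𝓞 K) K)) γ' = γ := hγ
  obtain ⟨u, hu, d, hd, rfl⟩ := Set.mem_mul.1 hω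
  obtain ⟨m, hm1, rfl⟩ := mem_normOneDiagonal_iff.1 hd
  subst hz
  obtain ⟨j, hj⟩ := exists_apply_ne_zero_of_row γ'⁻¹ ⟨n - 1, by omega⟩
  have hu' : u⁻¹ ∈ upperUnitriangular (Fin n) (AdeleRing (𝓞 K) K) := Subgroup.inv_mem _ hu
  -- the idèle occupying the `(n,j)` slot of the inverse
  set uι : ideleGroup K := (posRealIdele K (a ⟨n - 1, by omega⟩))⁻¹ * (m ⟨n - 1, by omega⟩)⁻¹ * ((posRealIdele K r)⁻¹ *
    Units.map (algebraMap K (AdeleRing (𝓞 K) K) : K →* AdeleRing (𝓞 K) K) (Units.mk0 _ hj)) with huι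
  have hinv : (Matrix.GeneralLinearGroup.map (algebraMap K (AdeleRing (𝓞 K) K)) γ' * posRealScalar n K r *
      (u * glDiagonal n (AdeleRing (𝓞 K) K) m * posRealDiagonal n K a))⁻¹ =
      posRealDiagonal n K a⁻¹ * glDiagonal n (AdeleRing (𝓞 K) K) m⁻¹ * u⁻¹ *
        (posRealScalar n K r⁻¹ * Matrix.GeneralLinearGroup.map (algebraMap K (AdeleRing (𝓞 K) K)) γ'⁻¹) := by
    simp only [mul_inv_rev, map_inv, mul_assoc]
  have hentry : (((Matrix.GeneralLinearGroup.map (algebraMap K (AdeleRing (𝓞 K) K)) γ' * posRealScalar n K r *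
      (u * glDiagonal n (AdeleRing (𝓞 K) K) m * posRealDiagonal n K a))⁻¹ : GL (Fin n) (AdeleRing (𝓞 K) K)) :
        Matrix (Fin n) (Fin n) (AdeleRing (𝓞 K) K)) ⟨n - 1, by omega⟩ j = (uι : AdeleRing (𝓞 K) K) := by
    rw [hinv, posRealScalar_eq_posRealDiagonal_const]
    simp only [Units.val_mul, coe_posRealDiagonal, coe_glDiagonal]
    rw [Matrix.diagonal_mul_diagonal, diagonal_mul_unip_mul_apply_last _ hu' _ hn j, Matrix.diagonal_mul,
      Matrix.GeneralLinearGroup.map_apply]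
    rw [huι]
    simp only [Units.val_mul, Units.coe_map, MonoidHom.coe_coe, Units.val_mk0, Pi.inv_apply, map_inv]
  have hnorm : (IdeleClassGroup.ideleNorm K uι : ℝ) =
      ((((a ⟨n - 1, by omega⟩ : ℝ≥0) : ℝ) * ((r : ℝ≥0) : ℝ))⁻¹) ^ Module.finrank ℚ K := by
    rw [huι, map_mul, map_mul, map_mul, map_inv, map_inv, map_inv, ideleNorm_principal ⟨Units.mk0 _ hj, rfl⟩,
      hm1 ⟨n - 1, by omega⟩, ideleNorm_posRealIdele_holds K r, ideleNorm_posRealIdele_holds K (a ⟨n - 1, by omega⟩)]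
    push_cast
    rw [inv_pow, mul_pow, mul_inv, inv_one, mul_one, mul_one]
  exact le_adelicHeightGL_of_ideleNorm_eq_pow _ ⟨n - 1, by omega⟩ j uι (Or.inr hentry) hnorm

end Entries

/-! ## 3. The comparison -/

section Comparison

variable {K : Type} [Field K] [NumberField K] {n : ℕ}

/-- **`a₁/aₙ ≤ ‖g₀‖²` for `g₀ = γ · ρ(r) · ω · ρ(a)`** ((B) × (C)). [cite: MoeglinWaldspurger1995, I.2.2 (vii)] -/
theorem first_div_last_le_adelicHeightGL_sq (hn : 0 < n) {γ z ω : GL (Fin n) (AdeleRing (𝓞 K) K)} (hγ : γ ∈ rationalPointsGL n K)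
    (hz : z ∈ (posRealScalar n K).range)
    (hω : ω ∈ (upperUnitriangular (Fin n) (AdeleRing (𝓞 K) K) : Set (GL (Fin n) (AdeleRing (𝓞 K) K))) *
      (normOneDiagonal n K : Set (GL (Fin n) (AdeleRing (𝓞 K) K))))
    (a : Fin n → ℝ≥0ˣ) :
    ((a ⟨0, hn⟩ : ℝ≥0) : ℝ) / ((a ⟨n - 1, by omega⟩ : ℝ≥0) : ℝ) ≤
      adelicHeightGL n K (γ * z * (ω * posRealDiagonal n K a)) ^ 2 := by
  obtain ⟨r, hr⟩ := hz
  have hB := first_mul_le_adelicHeightGL hn hγ hr hω a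
  have hC := last_mul_inv_le_adelicHeightGL hn hγ hr hω a
  have hrpos : 0 < ((r : ℝ≥0) : ℝ) := NNReal.coe_pos.2 (pos_iff_ne_zero.2 r.ne_zero)
  have hal : 0 < ((a ⟨n - 1, by omega⟩ : ℝ≥0) : ℝ) := NNReal.coe_pos.2 (pos_iff_ne_zero.2 (a _).ne_zero)
  have heq : ((a ⟨0, hn⟩ : ℝ≥0) : ℝ) / ((a ⟨n - 1, by omega⟩ : ℝ≥0) : ℝ) =
      (((a ⟨0, hn⟩ : ℝ≥0) : ℝ) * ((r : ℝ≥0) : ℝ)) * (((a ⟨n - 1, by omega⟩ : ℝ≥0) : ℝ) * ((r : ℝ≥0) : ℝ))⁻¹ := by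
    field_simp
  rw [heq, sq]
  exact mul_le_mul hB hC (by positivity) (adelicHeightGL_nonneg _)

/-- **THE SIEGEL-HEIGHT COMPARISON (Moeglin–Waldspurger I.2.2 (vii), quadratic form).**  For `n ≥ 1` and `t > 0` there is `C > 0`
such that for every reduced word `g = γ · z · (ω · ρ(a) · k)` — `γ ∈ GL_n(K)`, `z ∈ A_G`, `ω ∈ N(𝔸_K) T(𝔸_K)¹`, `ρ(a)` in the cone
`∏ aᵢ = 1`, `t aᵢ₊₁ ≤ aᵢ`, `k ∈ K` — every torus coordinate satisfies `aᵢ ≤ C ‖g‖²` and `aᵢ⁻¹ ≤ C ‖g‖²`.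
[cite: MoeglinWaldspurger1995, I.2.2 (vii)] [cite: BorelJacquet1979, §1.2] -/
theorem exists_siegelCoord_le_adelicHeightGL_sq (hn : 0 < n) {t : ℝ} (ht : 0 < t) :
    ∃ C : ℝ, 0 < C ∧ ∀ (g γ z ω k : GL (Fin n) (AdeleRing (𝓞 K) K)) (a : Fin n → ℝ≥0ˣ),
      γ ∈ rationalPointsGL n K → z ∈ (posRealScalar n K).range →
      ω ∈ (upperUnitriangular (Fin n) (AdeleRing (𝓞 K) K) : Set (GL (Fin n) (AdeleRing (𝓞 K) K))) *
        (normOneDiagonal n K : Set (GL (Fin n) (AdeleRing (𝓞 K) K))) →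
      (∏ i, ((a i : ℝ≥0) : ℝ)) = 1 →
      (∀ i j : Fin n, (j : ℕ) = (i : ℕ) + 1 → t * ((a j : ℝ≥0) : ℝ) ≤ ((a i : ℝ≥0) : ℝ)) →
      k ∈ standardMaximalCompactGL n K → g = γ * z * (ω * posRealDiagonal n K a * k) →
      ∀ i, ((a i : ℝ≥0) : ℝ) ≤ C * adelicHeightGL n K g ^ 2 ∧ (((a i : ℝ≥0) : ℝ))⁻¹ ≤ C * adelicHeightGL n K g ^ 2 := by
  obtain ⟨B, hB0, hB⟩ := exists_adelicHeightGL_le_of_isCompact (isCompact_standardMaximalCompactGL n K)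
  set B' : ℝ := max B 1 with hB'
  have hB'1 : 1 ≤ B' := le_max_right _ _
  set M : ℝ := max 1 t⁻¹ with hM
  refine ⟨M ^ (2 * n) * ((n : ℝ) * B') ^ 2, by positivity, ?_⟩
  intro g γ z ω k a hγ hz hω hprod hroot hk hg i
  -- `g₀ = g k⁻¹` and its height
  set g₀ : GL (Fin n) (AdeleRing (𝓞 K) K) := γ * z * (ω * posRealDiagonal n K a) with hg₀
  have hg₀' : g₀ = g * k⁻¹ := by
    rw [hg, hg₀]
    simp only [mul_assoc, mul_inv_cancel, mul_one]
  have hk' : adelicHeightGL n K k⁻¹ ≤ B' := (hB _ (Subgroup.inv_mem _ hk)).trans (le_max_left _ _)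
  have hH : adelicHeightGL n K g₀ ≤ (n : ℝ) * B' * adelicHeightGL n K g := by
    rw [hg₀']
    calc adelicHeightGL n K (g * k⁻¹) ≤ n * adelicHeightGL n K g * adelicHeightGL n K k⁻¹ := adelicHeightGL_mul_le_const g k⁻¹
      _ ≤ n * adelicHeightGL n K g * B' := mul_le_mul_of_nonneg_left hk' (by positivity [adelicHeightGL_nonneg g])
      _ = (n : ℝ) * B' * adelicHeightGL n K g := by ring
  have hquot : ((a ⟨0, hn⟩ : ℝ≥0) : ℝ) / ((a ⟨n - 1, by omega⟩ : ℝ≥0) : ℝ) ≤ ((n : ℝ) * B') ^ 2 * adelicHeightGL n K g ^ 2 := by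
    refine (first_div_last_le_adelicHeightGL_sq hn hγ hz hω a).trans ?_
    rw [← mul_pow]
    exact pow_le_pow_left₀ (adelicHeightGL_nonneg _) hH 2
  have hMn : 0 ≤ M ^ (2 * n) := by positivity
  refine ⟨?_, ?_⟩
  · calc ((a i : ℝ≥0) : ℝ) ≤ M ^ (2 * n) * (((a ⟨0, hn⟩ : ℝ≥0) : ℝ) / ((a ⟨n - 1, by omega⟩ : ℝ≥0) : ℝ)) :=
          siegelCone_apply_le ht hn hprod hroot i
      _ ≤ M ^ (2 * n) * (((n : ℝ) * B') ^ 2 * adelicHeightGL n K g ^ 2) := mul_le_mul_of_nonneg_left hquot hMn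
      _ = M ^ (2 * n) * ((n : ℝ) * B') ^ 2 * adelicHeightGL n K g ^ 2 := by ring
  · calc (((a i : ℝ≥0) : ℝ))⁻¹ ≤ M ^ (2 * n) * (((a ⟨0, hn⟩ : ℝ≥0) : ℝ) / ((a ⟨n - 1, by omega⟩ : ℝ≥0) : ℝ)) :=
          siegelCone_inv_apply_le ht hn hprod hroot i
      _ ≤ M ^ (2 * n) * (((n : ℝ) * B') ^ 2 * adelicHeightGL n K g ^ 2) := mul_le_mul_of_nonneg_left hquot hMn
      _ = M ^ (2 * n) * ((n : ℝ) * B') ^ 2 * adelicHeightGL n K g ^ 2 := by ring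

/-- **Siegel-set form**: for a Siegel set `S = Ω · A_{T₀}(t) · K` (★ `IsSiegelSetGL`) there is `C > 0` with: every
`g ∈ GL_n(K) · A_G · S` is `γ · z · (ω · ρ(a) · k)` for some cone parameter `a` all of whose coordinates satisfy
`aᵢ, aᵢ⁻¹ ≤ C ‖g‖²` (the word itself is returned, for use with automorphy). [cite: MoeglinWaldspurger1995, I.2.2 (vii)] -/
theorem exists_word_siegelCoord_le_adelicHeightGL_sq (hn : 0 < n) {S : Set (GL (Fin n) (AdeleRing (𝓞 K) K))}
    (hS : IsSiegelSetGL n K S) :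
    ∃ (t : ℝ) (C : ℝ), 0 < t ∧ 0 < C ∧ ∀ g ∈ (rationalPointsGL n K : Set (GL (Fin n) (AdeleRing (𝓞 K) K))) *
        ((posRealScalar n K).range : Set (GL (Fin n) (AdeleRing (𝓞 K) K))) * S,
      ∃ (γ z ω k : GL (Fin n) (AdeleRing (𝓞 K) K)) (a : Fin n → ℝ≥0ˣ),
        γ ∈ rationalPointsGL n K ∧ z ∈ (posRealScalar n K).range ∧
        ω ∈ (upperUnitriangular (Fin n) (AdeleRing (𝓞 K) K) : Set (GL (Fin n) (AdeleRing (𝓞 K) K))) *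
          (normOneDiagonal n K : Set (GL (Fin n) (AdeleRing (𝓞 K) K))) ∧
        (∏ i, ((a i : ℝ≥0) : ℝ)) = 1 ∧
        (∀ i j : Fin n, (j : ℕ) = (i : ℕ) + 1 → t * ((a j : ℝ≥0) : ℝ) ≤ ((a i : ℝ≥0) : ℝ)) ∧
        k ∈ standardMaximalCompactGL n K ∧ g = γ * z * (ω * posRealDiagonal n K a * k) ∧
        ∀ i, ((a i : ℝ≥0) : ℝ) ≤ C * adelicHeightGL n K g ^ 2 ∧ (((a i : ℝ≥0) : ℝ))⁻¹ ≤ C * adelicHeightGL n K g ^ 2 := by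
  obtain ⟨Ω, t, ht, hΩ, -, rfl⟩ := hS
  obtain ⟨C, hC, hmain⟩ := exists_siegelCoord_le_adelicHeightGL_sq (K := K) hn ht
  refine ⟨t, C, ht, hC, fun g hg => ?_⟩
  obtain ⟨q, hq, s, hs, rfl⟩ := Set.mem_mul.1 hg
  obtain ⟨γ, hγ, z, hz, rfl⟩ := Set.mem_mul.1 hq
  obtain ⟨p, hp, k, hk, rfl⟩ := Set.mem_mul.1 hs
  obtain ⟨ω, hω, c, hc, rfl⟩ := Set.mem_mul.1 hp
  obtain ⟨a, hprod, hroot, rfl⟩ := hc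
  exact ⟨γ, z, ω, k, a, hγ, hz, hΩ hω, hprod, hroot, hk, rfl,
    hmain _ γ z ω k a hγ hz (hΩ hω) hprod hroot hk rfl⟩

end Comparison

end Summit.HodgeConjecture.HodgeConjecture.Cruxes.HLiu418.K2LiuSiegelHeightComparisonGLn

end
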